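import Summits.BirchSwinnertonDyer.BirchSwinnertonDyer.Theorems.SmallImageMuTransferMuTransferX9StepsTwoFourTransportDistinguished
import Summits.BirchSwinnertonDyer.BirchSwinnertonDyer.Theorems.SmallImageMuTransferMuTransferX9StepTwoElement
import HarnessLib

/-!
# Route ByReductionTypeAtTwo, crux `OrdKatoHalfAtTwoIso` (stmt-BirchSwinnertonDyer-19573), line `steinberg-fibre-at-two`,
# registered stub `stub_HK_kolyvaginRankOneTwo` (Ω2 = H-K), interior: from the stub's GLOBAL transposition Frobenius
# `Fr` at `𝔓 ∣ q` to EVERY LOCAL Frobenius `r` of `ℚ_q` — `ρ(res r)` is a CONJUGATE of `ρ(Fr)`, `κ(res r) = κ(Fr)`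

Seat `cruxlead-stmt-BirchSwinnertonDyer-19573-g0` (LEAD PROVER, MODE LINE; HOME `run/shared/lean/pub/bsd-2adic/`).
THEOREMS ONLY. HONEST FRAMING (cell bsd-2adic): BSD is not proved by any of this; the crux is not proved;
`--supports` helper toward the lead's registered research stub `stub_HK_kolyvaginRankOneTwo : KolyvaginRankOneTwo`,
closing nothing. Generalises x9's `StepsTwoFourTransport.apply_absGaloisRestrict_eq_one_and_mem_layerSubgroup_iff_of_isArithFrobAt`
(`…X9StepsTwoFourTransportDistinguished.lean:190`, the `E`-SPLIT case `ρ(Fr) = 1`) to an ARBITRARY Frobenius: for a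
representation `ρ` unramified at `v ∤ p` and a `ℤ_p`-extension `κ`, every local arithmetic Frobenius `r` of `K_v` has
`ρ(res r) = ρ(t·Fr·t⁻¹)` for a `t ∈ Γ_K` independent of `r`, and `res r ∈ Γ^{pⁿ} ↔ Fr ∈ Γ^{pⁿ}`. Hence (curve
level, `p = 2`): `ρ̄₂(res r)² = 1`, `ρ̄₂(res r) ≠ 1` transfer from `Fr` — the binders of the transposition q-term
identity and of the `p = 2` value input.

References: J. Neukirch, *Algebraic Number Theory* (1999) Ch. I §9, Ch. II §9 [NeukirchANT1999]; L. Washington,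
*Introduction to Cyclotomic Fields* (1997) Prop. 13.2 [Washington1997].
-/

set_option linter.dupNamespace false
set_option autoImplicit false

noncomputable section

open scoped NumberField
open Field IsDedekindDomain NumberField
open Literature.NumberTheory.GaloisRepresentations
open Literature.NumberTheory.GaloisRepresentations.IsNonarchimedeanLocalField
open Literature.NumberTheory.EllipticCurves
open Rat.HeightOneSpectrum
open Summit.BirchSwinnertonDyer.BirchSwinnertonDyer.Rank1Residual
open Summit.BirchSwinnertonDyer.BirchSwinnertonDyer.Rank1Residual.StepsTwoFourTransport

namespace Summit.BirchSwinnertonDyer.BirchSwinnertonDyer.Theorems.SteinbergFibreAtTwo.LocalFrobenius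

universe u

section General

variable {K : Type u} [Field K] [NumberField K] {M : Type u} [AddCommGroup M] [TopologicalSpace M]
  [DiscreteTopology M] (ρ : DiscreteGaloisModule K M) {p : ℕ} [Fact p.Prime] (κ : ZpExtension K p)

/-- **Every local Frobenius is a conjugate of the given global one, on an unramified representation, and has
the same `κ`-value.** For `v ∤ p`, `ρ` unramified at `v`, `𝔓 ∣ v`, `Fr` an arithmetic Frobenius at `𝔓`: there is
`t ∈ Γ_K` such that for EVERY arithmetic Frobenius `r` of `K_v`: `ρ(res r) = ρ(t·Fr·t⁻¹)` and `κ(res r) = κ(Fr)`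
(`res r = j·(t Fr t⁻¹)` with `j ∈ I_{𝔓₀}`, killed by `ρ` and `κ`). [cite: NeukirchANT1999, Ch. II §9 Prop. (9.6)]
[cite: Washington1997, Prop. 13.2] -/
theorem exists_forall_apply_absGaloisRestrict_eq_conj {v : HeightOneSpectrum (𝓞 K)}
    (hunr : GaloisRep.IsUnramifiedAt v ρ) (hvp : (p : 𝓞 K) ∉ v.asIdeal)
    {𝔓 : Ideal (absIntegers (𝓞 K) K)} (h𝔓 : 𝔓 ∈ v.primesAbove) {Fr : absoluteGaloisGroup K}
    (hFr : IsArithFrobAt (𝓞 K) Fr 𝔓) :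
    ∃ t : absoluteGaloisGroup K, ∀ {r : absoluteGaloisGroup (v.adicCompletion K)}, IsAbsArithFrob r →
      ρ (absGaloisRestrict K (v.adicCompletion K) r) = ρ (t * Fr * t⁻¹) ∧
        κ (absGaloisRestrict K (v.adicCompletion K) r) = κ Fr := by
  classical
  obtain ⟨t, -, ht⟩ := exists_forall_isAbsArithFrob_mul_inv_conj_mem_map_absInertia h𝔓 hFr
  refine ⟨t, fun {r} hr => ?_⟩
  set ρr := absGaloisRestrict K (v.adicCompletion K) r with hρr
  have hjI : ρr * (t * Fr * t⁻¹)⁻¹ ∈ (adicCompletionPrime K v).inertia (absoluteGaloisGroup K) := by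
    rw [inertia_adicCompletionPrime_eq_map_absInertia]
    exact ht r hr
  have hρj : ρ (ρr * (t * Fr * t⁻¹)⁻¹) = 1 := hunr _ (adicCompletionPrime_mem_primesAbove K v) _ hjI
  have hκj : κ (ρr * (t * Fr * t⁻¹)⁻¹) = 1 :=
    ZpExtension.mem_kerSubgroup.1
      (ZpExtension.inertia_le_kerSubgroup_holds K p κ hvp (adicCompletionPrime_mem_primesAbove K v) hjI)
  have hdec : ρr = ρr * (t * Fr * t⁻¹)⁻¹ * (t * Fr * t⁻¹) := by group
  refine ⟨?_, ?_⟩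
  · rw [hdec, map_mul, hρj, one_mul]
  · rw [hdec, map_mul, hκj, one_mul, map_mul, map_mul, map_inv, mul_comm (κ t), mul_assoc,
      mul_inv_cancel, mul_one]

/-- Layer membership transfers between the global Frobenius and every local one. [cite: Washington1997, Prop. 13.2] -/
theorem absGaloisRestrict_mem_layerSubgroup_iff {v : HeightOneSpectrum (𝓞 K)}
    (hunr : GaloisRep.IsUnramifiedAt v ρ) (hvp : (p : 𝓞 K) ∉ v.asIdeal)
    {𝔓 : Ideal (absIntegers (𝓞 K) K)} (h𝔓 : 𝔓 ∈ v.primesAbove) {Fr : absoluteGaloisGroup K}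
    (hFr : IsArithFrobAt (𝓞 K) Fr 𝔓) {r : absoluteGaloisGroup (v.adicCompletion K)} (hr : IsAbsArithFrob r)
    (n : ℕ) : absGaloisRestrict K (v.adicCompletion K) r ∈ κ.layerSubgroup n ↔ Fr ∈ κ.layerSubgroup n := by
  obtain ⟨t, ht⟩ := exists_forall_apply_absGaloisRestrict_eq_conj ρ κ hunr hvp h𝔓 hFr
  rw [ZpExtension.mem_layerSubgroup, ZpExtension.mem_layerSubgroup, (ht hr).2]

end General

section Curve

variable (W : WeierstrassCurve ℚ) (κ : ZpExtension ℚ 2)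

/-- **At a transposition Frobenius, every local Frobenius is a transposition** (`p = 2`, `E[2]` unramified at
`q ∤ 2`): `ρ̄₂(res r)` is a conjugate of `ρ̄₂(Fr)`, so `ρ̄₂(res r)² = 1` and `ρ̄₂(res r) ≠ 1` follow from the same
for `Fr`; and `res r ∈ Γ^{2ⁿ} ↔ Fr ∈ Γ^{2ⁿ}`. [cite: NeukirchANT1999, Ch. II §9 Prop. (9.6)] [cite: Washington1997, Prop. 13.2] -/
theorem galoisRepTorsion_absGaloisRestrict_of_isArithFrobAt {q : HeightOneSpectrum (𝓞 ℚ)}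
    (hur : GaloisRep.IsUnramifiedAt q (W.torsionGaloisModule ((2 : ℕ) : ℤ)))
    (hqp : ((2 : ℕ) : 𝓞 ℚ) ∉ q.asIdeal) {𝔓 : Ideal (absIntegers (𝓞 ℚ) ℚ)} (h𝔓 : 𝔓 ∈ q.primesAbove)
    {Fr : absoluteGaloisGroup ℚ} (hFr : IsArithFrobAt (𝓞 ℚ) Fr 𝔓)
    (hT : WeierstrassCurve.galoisRepTorsion W 2 (Fr * Fr) = 1) (hT1 : WeierstrassCurve.galoisRepTorsion W 2 Fr ≠ 1)
    {r : absoluteGaloisGroup (q.adicCompletion ℚ)} (hr : IsAbsArithFrob r) :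
    WeierstrassCurve.galoisRepTorsion W 2
        (absGaloisRestrict ℚ (q.adicCompletion ℚ) r * absGaloisRestrict ℚ (q.adicCompletion ℚ) r) = 1 ∧
      WeierstrassCurve.galoisRepTorsion W 2 (absGaloisRestrict ℚ (q.adicCompletion ℚ) r) ≠ 1 ∧
      ∀ n : ℕ, absGaloisRestrict ℚ (q.adicCompletion ℚ) r ∈ κ.layerSubgroup n ↔ Fr ∈ κ.layerSubgroup n := by
  haveI : Fact (2 : ℕ).Prime := ⟨Nat.prime_two⟩
  obtain ⟨t, ht⟩ := exists_forall_apply_absGaloisRestrict_eq_conj (W.torsionGaloisModule ((2 : ℕ) : ℤ)) κ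
    hur hqp h𝔓 hFr
  obtain ⟨hρ, hκ⟩ := ht hr
  -- `ρ̄₂(res r) = ρ̄₂(t Fr t⁻¹)` as elements of `Aut E[2]`
  have hsmul : ∀ P : WeierstrassCurve.geomTorsion W ((2 : ℕ) : ℤ),
      absGaloisRestrict ℚ (q.adicCompletion ℚ) r • P = (t * Fr * t⁻¹) • P := fun P => by
    rw [← WeierstrassCurve.torsionGaloisModule_apply_apply, ← WeierstrassCurve.torsionGaloisModule_apply_apply, hρ]
  have hgal : WeierstrassCurve.galoisRepTorsion W 2 (absGaloisRestrict ℚ (q.adicCompletion ℚ) r) =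
      WeierstrassCurve.galoisRepTorsion W 2 (t * Fr * t⁻¹) := by
    have h1 : WeierstrassCurve.galoisRepTorsion W 2
        (absGaloisRestrict ℚ (q.adicCompletion ℚ) r * (t * Fr * t⁻¹)⁻¹) = 1 :=
      galoisRepTorsion_eq_one_of_forall_smul_eq W 2 fun P => by
        rw [mul_smul, hsmul, smul_inv_smul]
    have h2 : WeierstrassCurve.galoisRepTorsion W 2 (absGaloisRestrict ℚ (q.adicCompletion ℚ) r) =
        WeierstrassCurve.galoisRepTorsion W 2
          (absGaloisRestrict ℚ (q.adicCompletion ℚ) r * (t * Fr * t⁻¹)⁻¹ * (t * Fr * t⁻¹)) := by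
      rw [inv_mul_cancel_right]
    rw [h2, map_mul, h1, one_mul]
  refine ⟨?_, ?_, fun n => ?_⟩
  · rw [map_mul, hgal, ← map_mul]
    have : t * Fr * t⁻¹ * (t * Fr * t⁻¹) = t * (Fr * Fr) * t⁻¹ := by group
    rw [this, map_mul, map_mul, hT, mul_one, ← map_mul, mul_inv_cancel, map_one]
  · intro h1
    apply hT1
    rw [hgal, map_mul, map_mul, map_inv] at h1
    -- `ρ(t) ρ(Fr) ρ(t)⁻¹ = 1 ⟹ ρ(Fr) = 1`
    have h2 : WeierstrassCurve.galoisRepTorsion W 2 Fr =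
        (WeierstrassCurve.galoisRepTorsion W 2 t)⁻¹ *
          (WeierstrassCurve.galoisRepTorsion W 2 t * WeierstrassCurve.galoisRepTorsion W 2 Fr *
            (WeierstrassCurve.galoisRepTorsion W 2 t)⁻¹) * WeierstrassCurve.galoisRepTorsion W 2 t := by group
    rw [h2, h1, mul_one, inv_mul_cancel]
  · rw [ZpExtension.mem_layerSubgroup, ZpExtension.mem_layerSubgroup, hκ]

end Curve

end Summit.BirchSwinnertonDyer.BirchSwinnertonDyer.Theorems.SteinbergFibreAtTwo.LocalFrobenius

end
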